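import Summits.NavierStokesRegularity.NavierStokesRegularity.Theorems.HubbleDynamoDilutionBudget
import HarnessLib

/-!
# Route `HubbleDynamo`, item `DilutionBudget` (stmt-NavierStokesRegularity-1938): closing file

The item's signature was REPAIRED on the ledger (refuter, 2026-08-27T09:18Z: the right-hand side
bracketed `(a / 2) * (∫ y, ‖curl U y‖ ^ 2) + ν * ∫ y, |∇ curl U|²_F`). With that reading the item is
literally the accepted tree theorem `hubbleDynamo_dilutionBudget`
(`Theorems/HubbleDynamoDilutionBudget.lean`): for a smooth Leray profile
`−νΔU + aU + a(y·∇)U + (U·∇)U + ∇P = 0`, `div U = 0` in the Type-I decay class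
`|U| ≤ C/(1+|y|)`, `|∇U| ≤ C/(1+|y|)²`, `|∇Ω| ≤ C/(1+|y|)³` (`Ω = curl U`) the enstrophy budget of
the steady induction equation is `∫ ⟪Ω, (Ω·∇)U⟫ = (a/2) ∫ |Ω|² + ν ∫ |∇Ω|²`.

(The route file's rendered decl `Theses.HubbleDynamo.DilutionBudget` still carries the pre-repair
text, whose right-hand side parses as `(a/2) * ∫ y, (‖Ω y‖² + ν * ∫ |∇Ω|²)`; the theorem below is
stated against the repaired signature verbatim.)

HONEST FRAMING: an integration-by-parts identity about hypothetical self-similar profiles; nothing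
here bears on Navier–Stokes regularity.
-/

noncomputable section

set_option linter.dupNamespace false

namespace Summit.NavierStokesRegularity.NavierStokesRegularity.Theorems

open Literature.Analysis.FluidPDE

/-- **Item `HubbleDynamo.DilutionBudget` (stmt-NavierStokesRegularity-1938), repaired signature
verbatim**: the dilution bonus `∫ ⟪Ω, (Ω·∇)U⟫ = (a/2) ∫ |Ω|² + ν ∫ |∇Ω|²` for smooth Leray profiles
in the Type-I decay class — the accepted tree theorem `hubbleDynamo_dilutionBudget`. -/
theorem hubbleDynamo_dilutionBudget_proof :
    ∀ (ν a : ℝ) (U : EuclideanSpace ℝ (Fin 3) → EuclideanSpace ℝ (Fin 3))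
      (P : EuclideanSpace ℝ (Fin 3) → ℝ), ContDiff ℝ (⊤ : ℕ∞) U → ContDiff ℝ (⊤ : ℕ∞) P →
      Literature.Analysis.FluidPDE.IsLerayProfile ν a U P →
      (∃ C : ℝ, ∀ y, ‖U y‖ ≤ C / (1 + ‖y‖) ∧ ‖fderiv ℝ U y‖ ≤ C / (1 + ‖y‖) ^ 2 ∧
        ‖fderiv ℝ (Literature.Analysis.FluidPDE.curl U) y‖ ≤ C / (1 + ‖y‖) ^ 3) →
      ∫ y, inner ℝ (Literature.Analysis.FluidPDE.curl U y)
          (fderiv ℝ U y (Literature.Analysis.FluidPDE.curl U y)) =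
        (a / 2) * (∫ y, ‖Literature.Analysis.FluidPDE.curl U y‖ ^ 2) +
          ν * ∫ y, Literature.Analysis.FluidPDE.frobeniusNormSq
            (fderiv ℝ (Literature.Analysis.FluidPDE.curl U) y) :=
  hubbleDynamo_dilutionBudget

end Summit.NavierStokesRegularity.NavierStokesRegularity.Theorems

end
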